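import Literature.Probability.RandomPlanarGeometry.SAWCountMonotoneSharpOdd
import Literature.Probability.RandomPlanarGeometry.SAWCountMonotoneEven
import HarnessLib

/-!
# Doubly trapped walks exist at EVERY even length `n ≥ 8d - 6`, in EVERY dimension `d ≥ 2`:
# the doubly trapped threshold law as an iff in all dimensions

Sibling of `SAWCountMonotoneSharpOdd.lean` (odd lengths; coordinates `axisFin`, `spinePt`, signed
laterals `latVec`/`latFun`).  For the set `T₂ = doublyTrapped d n` of `SAWCountMonotoneReversal.lean`
(`n`-step self-avoiding walks on `ℤ^d` with a trapped END and at most one free site at the START;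
O'Brien's inequality `cₙ ≤ cₙ₊₁` follows from `cₙ ≤ cₙ₊₁ + #T₂` wherever `T₂ = ∅`) the tree has
`T₂ = ∅` for even `n ≤ 8d - 8` (`SAWCountMonotoneEven.lean`) and for odd `n ≤ 6d - 5`
(`SAWCountMonotoneOdd.lean`), and `T₂ ≠ ∅` for odd `n ≥ 6d - 3` (`SAWCountMonotoneSharpOdd.lean`).
Here the even lengths:

* `evenWitness m k` : an explicit `(8m + 18 + 2k)`-step walk on `ℤ^{m+3}` (in-plane frame through
  `(k+2)e₀`, `2e₀ + 2e₁`, `2e₁`, then the petals `{u, e₀ + u, e₀ + e₁ + u}` over the `2m + 2` signed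
  unit vectors `u` orthogonal to the plane, the first two joined through `-e₀`, the others by corners;
  end `e₀ + e₁` caged, start with the single free neighbour `-e₁`) — the uniform form of the
  `d = 3, …, 6` witnesses of `SAWCountMonotoneWitnesses.lean`;
* `evenWitnessTwo k` : the planar family (`ℤ²` has no third axis): `0, -e₀, -e₀+e₁, e₁, 2e₁, e₀+2e₁,
  2e₀+2e₁, 2e₀+e₁, …, (k+2)e₀+e₁, (k+2)e₀, …, e₀, e₀+e₁`;
* `doublyTrapped_nonempty_of_even` : **`T₂(d, n) ≠ ∅` for every `d ≥ 2` and every even `n` with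
  `8d ≤ n + 6`**;
* `doublyTrapped_eq_empty_iff` : **the threshold law** — for `d ≥ 2`,
  `T₂(d, n) = ∅ ↔ (n odd ∧ n + 5 ≤ 6d) ∨ (n even ∧ n + 7 ≤ 8d)`; so the reversal pairing proves
  O'Brien's inequality exactly for `n ≤ 6d - 4` and the even `n ≤ 8d - 8`, in every dimension.

No named facts are introduced (lane construction, `FINDING-OBRIEN-THRESHOLD-LAW.md`).

[cite: MadrasSlade1993, §1.1 (self-avoiding walks on `ℤ^d`); §7.1 p. 231 (`c_{N+1} ≥ c_N`, O'Brien)]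
[cite: BDGS2012, §1.3 (`cₙ ≤ cₙ₊₁`, O'Brien 1990)]
-/

open Literature.Probability.LatticeModels Literature.Probability.Percolation SimpleGraph

namespace Literature.Probability.RandomPlanarGeometry.SAW.Zd

/-! ### The in-plane second axis -/

/-- The unit vector `e₁` of the second axis. [cite: MadrasSlade1993, §1.1] -/
def planeVec (m : ℕ) : Site (m + 2) := Pi.single (axisFin m 1) 1

/-- The second coordinate `x₁`. [cite: MadrasSlade1993, §1.1] -/
def planeCoord (m : ℕ) (x : Site (m + 2)) : ℤ := x (axisFin m 1)

section Plane

variable {m : ℕ}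

/-- `planeCoord` is additive. [cite: MadrasSlade1993, §1.1] -/
@[simp] theorem planeCoord_add (x y : Site (m + 2)) :
    planeCoord m (x + y) = planeCoord m x + planeCoord m y := rfl

/-- `planeCoord` of a negative. [cite: MadrasSlade1993, §1.1] -/
@[simp] theorem planeCoord_neg (x : Site (m + 2)) : planeCoord m (-x) = -planeCoord m x := rfl

/-- `planeCoord (c e₀) = 0`. [cite: MadrasSlade1993, §1.1] -/
@[simp] theorem planeCoord_spinePt (c : ℤ) : planeCoord m (spinePt m c) = 0 := by
  simp [planeCoord, spinePt, Pi.single_eq_of_ne, axisFin_ne_zero]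

/-- `planeCoord e₁ = 1`. [cite: MadrasSlade1993, §1.1] -/
@[simp] theorem planeCoord_planeVec : planeCoord m (planeVec m) = 1 := by
  simp [planeCoord, planeVec]

/-- `spineCoord e₁ = 0`. [cite: MadrasSlade1993, §1.1] -/
@[simp] theorem spineCoord_planeVec : spineCoord m (planeVec m) = 0 := by
  simp [spineCoord, planeVec, Pi.single_eq_of_ne, (axisFin_ne_zero (m := m) le_rfl).symm]

/-- Laterals on the axes `≥ 2` have second coordinate `0`. [cite: MadrasSlade1993, §1.1] -/
@[simp] theorem planeCoord_latVec {p o : ℕ} (ho : 2 ≤ o) (hop : o + p ≤ m + 2) (j : ℕ) (hj : j < 2 * p) :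
    planeCoord m (latVec m p o j) = 0 := by
  unfold planeCoord latVec
  split_ifs with h
  · rw [Pi.single_eq_of_ne]
    intro h'; rw [axisFin_eq_iff (by omega) (by omega)] at h'; omega
  · rw [Pi.neg_apply, Pi.single_eq_of_ne, neg_zero]
    intro h'; rw [axisFin_eq_iff (by omega) (by omega)] at h'; omega

/-- Lateral functionals on the axes `≥ 2` vanish on `e₁`. [cite: MadrasSlade1993, §1.1] -/
@[simp] theorem latFun_planeVec {p o : ℕ} (ho : 2 ≤ o) (hop : o + p ≤ m + 2) (j : ℕ) (hj : j < 2 * p) :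
    latFun m p o j (planeVec m) = 0 := by
  unfold latFun planeVec
  split_ifs with h
  · rw [Pi.single_eq_of_ne]
    intro h'; rw [axisFin_eq_iff (by omega) (by omega)] at h'; omega
  · rw [Pi.single_eq_of_ne, neg_zero]
    intro h'; rw [axisFin_eq_iff (by omega) (by omega)] at h'; omega

/-- Adjacency along the second axis: `x ∼ x + e₁`. [cite: MadrasSlade1993, §1.1] -/
theorem adj_add_planeVec (x : Site (m + 2)) : (zdGraph (m + 2)).Adj x (x + planeVec m) :=
  (zdGraph_adj_iff _ _).2 ⟨axisFin m 1, Or.inl rfl⟩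

/-- Adjacency along the second axis: `x + e₁ ∼ x`. [cite: MadrasSlade1993, §1.1] -/
theorem adj_add_planeVec' (x : Site (m + 2)) : (zdGraph (m + 2)).Adj (x + planeVec m) x :=
  (adj_add_planeVec x).symm

end Plane

/-! ### The even witness in dimension `m + 3 ≥ 3` -/

/-- The `j`-th signed unit vector orthogonal to the plane, `j = 0, …, 2m+1`:
`e₂, …, e_{m+2}, -e₂, …, -e_{m+2}` (on `ℤ^{m+3}`). [cite: MadrasSlade1993, §1.1] -/
def evenLat (m j : ℕ) : Site (m + 1 + 2) := latVec (m + 1) (m + 1) 2 j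

/-- The signed coordinate dual to `evenLat m j`. [cite: MadrasSlade1993, §1.1] -/
def evenFun (m j : ℕ) (x : Site (m + 1 + 2)) : ℤ := latFun (m + 1) (m + 1) 2 j x

/-- The end `e = e₀ + e₁` of the even witness. [cite: BDGS2012, §1.3] -/
def evenEnd (m : ℕ) : Site (m + 1 + 2) := spinePt (m + 1) 1 + planeVec (m + 1)

/-- The fourteen sites after the padded excursion: `2e₀+2e₁, e₀+2e₁, 2e₁, e₁` (frame), the first petal
`e₁+u₀, e+u₀, e₀+u₀, u₀`, the transition `u₀-e₀, -e₀, -e₀+u₁, u₁`, and `e₀+u₁, e+u₁`. [cite: BDGS2012, §1.3] -/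
def evenHead (m s : ℕ) : Site (m + 1 + 2) :=
  if s = 0 then spinePt (m + 1) 2 + planeVec (m + 1) + planeVec (m + 1)
  else if s = 1 then spinePt (m + 1) 1 + planeVec (m + 1) + planeVec (m + 1)
  else if s = 2 then planeVec (m + 1) + planeVec (m + 1)
  else if s = 3 then planeVec (m + 1)
  else if s = 4 then planeVec (m + 1) + evenLat m 0
  else if s = 5 then evenEnd m + evenLat m 0
  else if s = 6 then spinePt (m + 1) 1 + evenLat m 0
  else if s = 7 then evenLat m 0
  else if s = 8 then spinePt (m + 1) (-1) + evenLat m 0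
  else if s = 9 then spinePt (m + 1) (-1)
  else if s = 10 then spinePt (m + 1) (-1) + evenLat m 1
  else if s = 11 then evenLat m 1
  else if s = 12 then spinePt (m + 1) 1 + evenLat m 1
  else evenEnd m + evenLat m 1

/-- The four sites of petal `j` (`2 ≤ j ≤ 2m+1`): for even `j` the corner `e + u_{j-1} + u_j`, then
`e + u_j`, `e₀ + u_j`, `u_j`; for odd `j` the corner `u_{j-1} + u_j`, then `u_j`, `e₀ + u_j`, `e + u_j`.
[cite: BDGS2012, §1.3] -/
def evenPetal (m j r : ℕ) : Site (m + 1 + 2) :=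
  if j % 2 = 0 then
    (if r = 0 then evenEnd m + evenLat m (j - 1) + evenLat m j
      else if r = 1 then evenEnd m + evenLat m j
      else if r = 2 then spinePt (m + 1) 1 + evenLat m j else evenLat m j)
  else
    (if r = 0 then evenLat m (j - 1) + evenLat m j
      else if r = 1 then evenLat m j
      else if r = 2 then spinePt (m + 1) 1 + evenLat m j else evenEnd m + evenLat m j)

/-- **The even witness** on `ℤ^{m+3}` with padding `k`: `0, e₀, …, (k+2)e₀`, `(k+2)e₀+e₁, …, 2e₀+e₁`,
the fourteen head sites, the petals `j = 2, …, 2m+1`, and the end `e₀ + e₁`; frozen after time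
`8m + 18 + 2k`. [cite: BDGS2012, §1.3] -/
def evenWitness (m k : ℕ) (t : ℕ) : Site (m + 1 + 2) :=
  if t ≤ k + 2 then spinePt (m + 1) (t : ℤ)
  else if t ≤ 2 * k + 3 then spinePt (m + 1) ((2 * k + 5 : ℕ) - (t : ℤ)) + planeVec (m + 1)
  else if t < 2 * k + 18 then evenHead m (t - (2 * k + 4))
  else if t ≤ 2 * k + 8 * m + 17 then evenPetal m ((t - (2 * k + 10)) / 4) ((t - (2 * k + 10)) % 4)
  else evenEnd m

section EvenWitness

variable {m k : ℕ}

/-! #### Values -/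

/-- Spine excursion. [cite: BDGS2012, §1.3] -/
theorem evenWitness_of_le {t : ℕ} (ht : t ≤ k + 2) : evenWitness m k t = spinePt (m + 1) (t : ℤ) := by
  simp [evenWitness, ht]

/-- Return along `x₁ = 1`. [cite: BDGS2012, §1.3] -/
theorem evenWitness_leg {t : ℕ} (h1 : k + 3 ≤ t) (h2 : t ≤ 2 * k + 3) :
    evenWitness m k t = spinePt (m + 1) ((2 * k + 5 : ℕ) - (t : ℤ)) + planeVec (m + 1) := by
  simp [evenWitness, show ¬ t ≤ k + 2 by omega, h2]

/-- Head phase. [cite: BDGS2012, §1.3] -/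
theorem evenWitness_head {s : ℕ} (hs : s < 14) : evenWitness m k (2 * k + 4 + s) = evenHead m s := by
  simp [evenWitness, show ¬ 2 * k + 4 + s ≤ k + 2 by omega, show ¬ 2 * k + 4 + s ≤ 2 * k + 3 by omega,
    show 2 * k + 4 + s < 2 * k + 18 by omega]

/-- Petal phase. [cite: BDGS2012, §1.3] -/
theorem evenWitness_petal {j r : ℕ} (hj : 2 ≤ j) (hj' : j ≤ 2 * m + 1) (hr : r < 4) :
    evenWitness m k (2 * k + 4 * j + 10 + r) = evenPetal m j r := by
  have h1 : ¬ 2 * k + 4 * j + 10 + r ≤ k + 2 := by omega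
  have h2 : ¬ 2 * k + 4 * j + 10 + r ≤ 2 * k + 3 := by omega
  have h3 : ¬ 2 * k + 4 * j + 10 + r < 2 * k + 18 := by omega
  have h4 : 2 * k + 4 * j + 10 + r ≤ 2 * k + 8 * m + 17 := by omega
  have h5 : (2 * k + 4 * j + 10 + r - (2 * k + 10)) / 4 = j := by omega
  have h6 : (2 * k + 4 * j + 10 + r - (2 * k + 10)) % 4 = r := by omega
  simp [evenWitness, h1, h2, h3, h4, h5, h6]

/-- End phase (frozen at `e₀ + e₁`). [cite: BDGS2012, §1.3] -/
theorem evenWitness_of_ge {t : ℕ} (ht : 2 * k + 8 * m + 18 ≤ t) : evenWitness m k t = evenEnd m := by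
  simp [evenWitness, show ¬ t ≤ k + 2 by omega, show ¬ t ≤ 2 * k + 3 by omega,
    show ¬ t < 2 * k + 18 by omega, show ¬ t ≤ 2 * k + 8 * m + 17 by omega]

/-- Every time `t ≤ 8m + 18 + 2k` lies in one of the five phases. [cite: BDGS2012, §1.3] -/
theorem evenWitness_zones {t : ℕ} (ht : t ≤ 2 * k + 8 * m + 18) :
    t ≤ k + 2 ∨ (k + 3 ≤ t ∧ t ≤ 2 * k + 3) ∨ (∃ s, s < 14 ∧ t = 2 * k + 4 + s) ∨
      (∃ j r, 2 ≤ j ∧ j ≤ 2 * m + 1 ∧ r < 4 ∧ t = 2 * k + 4 * j + 10 + r) ∨ t = 2 * k + 8 * m + 18 := by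
  rcases Nat.lt_or_ge t (k + 3) with h | h
  · exact Or.inl (by omega)
  rcases Nat.lt_or_ge t (2 * k + 4) with h' | h'
  · exact Or.inr (Or.inl ⟨h, by omega⟩)
  rcases Nat.lt_or_ge t (2 * k + 18) with h'' | h''
  · exact Or.inr (Or.inr (Or.inl ⟨t - (2 * k + 4), by omega, by omega⟩))
  rcases Nat.lt_or_ge t (2 * k + 8 * m + 18) with h3 | h3
  · refine Or.inr (Or.inr (Or.inr (Or.inl ⟨(t - (2 * k + 18)) / 4 + 2, (t - (2 * k + 18)) % 4,
      by omega, by omega, Nat.mod_lt _ (by norm_num), by omega⟩)))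
  · exact Or.inr (Or.inr (Or.inr (Or.inr (by omega))))

/-! #### Statistics -/

/-- `evenFun j` is additive. [cite: MadrasSlade1993, §1.1] -/
@[simp] theorem evenFun_add (j : ℕ) (x y : Site (m + 1 + 2)) :
    evenFun m j (x + y) = evenFun m j x + evenFun m j y := latFun_add j x y

/-- `evenFun j (c e₀) = 0`. [cite: MadrasSlade1993, §1.1] -/
@[simp] theorem evenFun_spinePt (j : ℕ) (c : ℤ) : evenFun m j (spinePt (m + 1) c) = 0 :=
  latFun_spinePt (by norm_num) j c

/-- `evenFun j (e₁) = 0` (`j ≤ 2m+1`). [cite: MadrasSlade1993, §1.1] -/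
theorem evenFun_planeVec {j : ℕ} (hj : j ≤ 2 * m + 1) : evenFun m j (planeVec (m + 1)) = 0 :=
  latFun_planeVec le_rfl (by omega) j (by omega)

/-- `evenFun j (e₀ + e₁) = 0` (`j ≤ 2m+1`). [cite: MadrasSlade1993, §1.1] -/
theorem evenFun_evenEnd {j : ℕ} (hj : j ≤ 2 * m + 1) : evenFun m j (evenEnd m) = 0 := by
  rw [evenEnd, evenFun_add, evenFun_spinePt, evenFun_planeVec hj, add_zero]

/-- `evenFun j (evenLat j) = 1`. [cite: MadrasSlade1993, §1.1] -/
@[simp] theorem evenFun_evenLat_self (j : ℕ) : evenFun m j (evenLat m j) = 1 := latFun_latVec_self j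

/-- `evenFun j (evenLat i) ≤ 0` for `i ≠ j` (indices `≤ 2m + 1`). [cite: MadrasSlade1993, §1.1] -/
theorem evenFun_evenLat_le {i j : ℕ} (hi : i ≤ 2 * m + 1) (hj : j ≤ 2 * m + 1) (hij : i ≠ j) :
    evenFun m j (evenLat m i) ≤ 0 :=
  latFun_latVec_le (by omega) (by omega) (by omega) hij

/-- Consecutive laterals are orthogonal (`2 ≤ j ≤ 2m+1` forces `m ≥ 1`). [cite: MadrasSlade1993, §1.1] -/
theorem evenFun_evenLat_pred {j : ℕ} (hj : 2 ≤ j) (hj' : j ≤ 2 * m + 1) :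
    evenFun m j (evenLat m (j - 1)) = 0 ∧ evenFun m (j - 1) (evenLat m j) = 0 :=
  ⟨latFun_latVec_eq_zero (by omega) (by omega) (by omega) (by omega) (by omega) (by omega),
    latFun_latVec_eq_zero (by omega) (by omega) (by omega) (by omega) (by omega) (by omega)⟩

/-- The spine coordinate of a lateral vanishes. [cite: MadrasSlade1993, §1.1] -/
@[simp] theorem spineCoord_evenLat (j : ℕ) : spineCoord (m + 1) (evenLat m j) = 0 :=
  spineCoord_latVec (by norm_num) j

/-- The second coordinate of a lateral vanishes (`j ≤ 2m+1`). [cite: MadrasSlade1993, §1.1] -/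
theorem planeCoord_evenLat {j : ℕ} (hj : j ≤ 2 * m + 1) : planeCoord (m + 1) (evenLat m j) = 0 :=
  planeCoord_latVec le_rfl (by omega) j (by omega)

/-- Coordinates of the end `e₀ + e₁`. [cite: BDGS2012, §1.3] -/
@[simp] theorem spineCoord_evenEnd : spineCoord (m + 1) (evenEnd m) = 1 := by simp [evenEnd]

/-- Coordinates of the end `e₀ + e₁`. [cite: BDGS2012, §1.3] -/
@[simp] theorem planeCoord_evenEnd : planeCoord (m + 1) (evenEnd m) = 1 := by simp [evenEnd]

/-- Spine coordinate of the head sites: `2, 1, 0, 0, 0, 1, 1, 0, -1, -1, -1, 0, 1, 1`. [cite: BDGS2012, §1.3] -/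
theorem spineCoord_evenHead (s : ℕ) :
    spineCoord (m + 1) (evenHead m s) =
      if s = 0 then 2 else if s = 1 then 1 else if s ≤ 4 then 0 else if s ≤ 6 then 1 else if s = 7 then 0
      else if s ≤ 10 then -1 else if s = 11 then 0 else 1 := by
  unfold evenHead
  by_cases h0 : s = 0; · subst h0; simp
  by_cases h1 : s = 1; · subst h1; simp
  by_cases h2 : s = 2; · subst h2; simp
  by_cases h3 : s = 3; · subst h3; simp
  by_cases h4 : s = 4; · subst h4; simp
  by_cases h5 : s = 5; · subst h5; simp
  by_cases h6 : s = 6; · subst h6; simp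
  by_cases h7 : s = 7; · subst h7; simp
  by_cases h8 : s = 8; · subst h8; simp
  by_cases h9 : s = 9; · subst h9; simp
  by_cases h10 : s = 10; · subst h10; simp
  by_cases h11 : s = 11; · subst h11; simp
  by_cases h12 : s = 12; · subst h12; simp
  simp [h0, h1, h2, h3, h4, h5, h6, h7, h8, h9, h10, h11, h12, show ¬ s ≤ 4 by omega,
    show ¬ s ≤ 6 by omega, show ¬ s ≤ 10 by omega]

/-- Second coordinate of the head sites: `2, 2, 2, 1, 1, 1, 0, 0, 0, 0, 0, 0, 0, 1`. [cite: BDGS2012, §1.3] -/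
theorem planeCoord_evenHead (s : ℕ) :
    planeCoord (m + 1) (evenHead m s) =
      if s ≤ 2 then 2 else if s ≤ 5 then 1 else if s ≤ 12 then 0 else 1 := by
  have h0' : planeCoord (m + 1) (evenLat m 0) = 0 := planeCoord_evenLat (by omega)
  have h1' : planeCoord (m + 1) (evenLat m 1) = 0 := planeCoord_evenLat (by omega)
  unfold evenHead
  by_cases h0 : s = 0; · subst h0; simp
  by_cases h1 : s = 1; · subst h1; simp
  by_cases h2 : s = 2; · subst h2; simp
  by_cases h3 : s = 3; · subst h3; simp
  by_cases h4 : s = 4; · subst h4; simp [h0']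
  by_cases h5 : s = 5; · subst h5; simp [h0']
  by_cases h6 : s = 6; · subst h6; simp [h0']
  by_cases h7 : s = 7; · subst h7; simp [h0']
  by_cases h8 : s = 8; · subst h8; simp [h0']
  by_cases h9 : s = 9; · subst h9; simp
  by_cases h10 : s = 10; · subst h10; simp [h1']
  by_cases h11 : s = 11; · subst h11; simp [h1']
  by_cases h12 : s = 12; · subst h12; simp [h1']
  simp [h0, h1, h2, h3, h4, h5, h6, h7, h8, h9, h10, h11, h12, h1', show ¬ s ≤ 2 by omega,
    show ¬ s ≤ 5 by omega, show ¬ s ≤ 12 by omega]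

/-- Lateral functionals of the head sites (`i ≤ 2m+1`). [cite: BDGS2012, §1.3] -/
theorem evenFun_evenHead {i : ℕ} (hi : i ≤ 2 * m + 1) (s : ℕ) :
    evenFun m i (evenHead m s) =
      if s ≤ 3 then 0 else if s ≤ 8 then evenFun m i (evenLat m 0) else if s = 9 then 0
      else evenFun m i (evenLat m 1) := by
  have hp : evenFun m i (planeVec (m + 1)) = 0 := evenFun_planeVec hi
  have he : evenFun m i (evenEnd m) = 0 := evenFun_evenEnd hi
  unfold evenHead
  by_cases h0 : s = 0; · subst h0; simp [hp]
  by_cases h1 : s = 1; · subst h1; simp [hp]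
  by_cases h2 : s = 2; · subst h2; simp [hp]
  by_cases h3 : s = 3; · subst h3; simp [hp]
  by_cases h4 : s = 4; · subst h4; simp [hp]
  by_cases h5 : s = 5; · subst h5; simp [he]
  by_cases h6 : s = 6; · subst h6; simp
  by_cases h7 : s = 7; · subst h7; simp
  by_cases h8 : s = 8; · subst h8; simp
  by_cases h9 : s = 9; · subst h9; simp
  by_cases h10 : s = 10; · subst h10; simp
  by_cases h11 : s = 11; · subst h11; simp
  by_cases h12 : s = 12; · subst h12; simp
  simp [h0, h1, h2, h3, h4, h5, h6, h7, h8, h9, h10, h11, h12, he, show ¬ s ≤ 3 by omega,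
    show ¬ s ≤ 8 by omega]

/-- Spine coordinate of the petal sites. [cite: BDGS2012, §1.3] -/
theorem spineCoord_evenPetal (j r : ℕ) :
    spineCoord (m + 1) (evenPetal m j r) =
      if j % 2 = 0 then (if r ≤ 2 then 1 else 0) else (if r ≤ 1 then 0 else 1) := by
  unfold evenPetal
  by_cases hj : j % 2 = 0 <;> by_cases h0 : r = 0 <;> by_cases h1 : r = 1 <;> by_cases h2 : r = 2 <;>
    simp [hj, h0, h1, h2] <;> omega

/-- Second coordinate of the petal sites (`1 ≤ j ≤ 2m+1`). [cite: BDGS2012, §1.3] -/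
theorem planeCoord_evenPetal {j : ℕ} (hj1 : 1 ≤ j) (hj' : j ≤ 2 * m + 1) (r : ℕ) :
    planeCoord (m + 1) (evenPetal m j r) =
      if j % 2 = 0 then (if r ≤ 1 then 1 else 0) else (if r ≤ 2 then 0 else 1) := by
  have ha : planeCoord (m + 1) (evenLat m j) = 0 := planeCoord_evenLat hj'
  have hb : planeCoord (m + 1) (evenLat m (j - 1)) = 0 := planeCoord_evenLat (by omega)
  unfold evenPetal
  by_cases hj : j % 2 = 0 <;> by_cases h0 : r = 0 <;> by_cases h1 : r = 1 <;> by_cases h2 : r = 2 <;>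
    simp [hj, h0, h1, h2, ha, hb] <;> omega

/-- Lateral functionals of the petal sites (`i, j ≤ 2m+1`). [cite: BDGS2012, §1.3] -/
theorem evenFun_evenPetal {i j : ℕ} (hi : i ≤ 2 * m + 1) (r : ℕ) :
    evenFun m i (evenPetal m j r) =
      (if r = 0 then evenFun m i (evenLat m (j - 1)) else 0) + evenFun m i (evenLat m j) := by
  have he : evenFun m i (evenEnd m) = 0 := evenFun_evenEnd hi
  unfold evenPetal
  by_cases hj : j % 2 = 0 <;> by_cases h0 : r = 0 <;> by_cases h1 : r = 1 <;> by_cases h2 : r = 2 <;>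
    simp [hj, h0, h1, h2, he]

/-- Before petal `j` starts, `evenFun j ≤ 0` along the walk. [cite: BDGS2012, §1.3] -/
theorem evenFun_evenWitness_nonpos {j t : ℕ} (hj : 2 ≤ j) (hj' : j ≤ 2 * m + 1)
    (ht : t < 2 * k + 4 * j + 10) : evenFun m j (evenWitness m k t) ≤ 0 := by
  have h0 : evenFun m j (evenLat m 0) ≤ 0 := evenFun_evenLat_le (by omega) hj' (by omega)
  have h1 : evenFun m j (evenLat m 1) ≤ 0 := evenFun_evenLat_le (by omega) hj' (by omega)
  have hp : evenFun m j (planeVec (m + 1)) = 0 := evenFun_planeVec hj'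
  rcases evenWitness_zones (m := m) (k := k) (t := t) (by omega) with
      hA | ⟨hB1, hB2⟩ | ⟨s, hs, rfl⟩ | ⟨j', r', hj1, hj2, hr, rfl⟩ | hE
  · rw [evenWitness_of_le hA, evenFun_spinePt]
  · rw [evenWitness_leg hB1 hB2, evenFun_add, evenFun_spinePt, hp, add_zero]
  · rw [evenWitness_head hs, evenFun_evenHead hj']
    split_ifs
    · exact le_rfl
    · exact h0
    · exact le_rfl
    · exact h1
  · rw [evenWitness_petal hj1 hj2 hr, evenFun_evenPetal hj']
    have hlt : j' < j := by omega
    have ha : evenFun m j (evenLat m j') ≤ 0 := evenFun_evenLat_le hj2 hj' (by omega)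
    have hb : evenFun m j (evenLat m (j' - 1)) ≤ 0 := evenFun_evenLat_le (by omega) hj' (by omega)
    split_ifs
    · linarith
    · linarith
  · omega

/-- On petal `j` the functional `evenFun j` equals `1`. [cite: BDGS2012, §1.3] -/
theorem evenFun_evenPetal_self {j : ℕ} (hj : 2 ≤ j) (hj' : j ≤ 2 * m + 1) (r : ℕ) :
    evenFun m j (evenPetal m j r) = 1 := by
  rw [evenFun_evenPetal hj', (evenFun_evenLat_pred hj hj').1, evenFun_evenLat_self]
  split_ifs <;> simp

/-- On petal `j` the functional `evenFun (j-1)` marks the corner. [cite: BDGS2012, §1.3] -/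
theorem evenFun_pred_evenPetal {j : ℕ} (hj : 2 ≤ j) (hj' : j ≤ 2 * m + 1) (r : ℕ) :
    evenFun m (j - 1) (evenPetal m j r) = if r = 0 then 1 else 0 := by
  rw [evenFun_evenPetal (by omega), (evenFun_evenLat_pred hj hj').2, evenFun_evenLat_self]
  split_ifs <;> simp

/-- No site before the end equals the end `e₀ + e₁`. [cite: BDGS2012, §1.3] -/
theorem evenWitness_ne_end {t : ℕ} (ht : t < 2 * k + 8 * m + 18) : evenWitness m k t ≠ evenEnd m := by
  intro heq
  have hX := congrArg (spineCoord (m + 1)) heq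
  have hY := congrArg (planeCoord (m + 1)) heq
  rw [spineCoord_evenEnd] at hX
  rw [planeCoord_evenEnd] at hY
  rcases evenWitness_zones (m := m) (k := k) (t := t) (by omega) with
      hA | ⟨hB1, hB2⟩ | ⟨s, hs, rfl⟩ | ⟨j', r', hj1, hj2, hr, rfl⟩ | hE
  · rw [evenWitness_of_le hA] at hY; simp at hY
  · rw [evenWitness_leg hB1 hB2] at hX
    simp only [spineCoord_add, spineCoord_spinePt, spineCoord_planeVec] at hX; omega
  · have h0 := congrArg (evenFun m 0) heq
    have h1 := congrArg (evenFun m 1) heq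
    rw [evenWitness_head hs] at hX hY h0 h1
    rw [spineCoord_evenHead] at hX
    rw [planeCoord_evenHead] at hY
    rw [evenFun_evenHead (by omega), evenFun_evenEnd (by omega)] at h0 h1
    simp only [evenFun_evenLat_self] at h0 h1
    split_ifs at hX hY h0 h1 <;> omega
  · have := congrArg (evenFun m j') heq
    rw [evenWitness_petal hj1 hj2 hr, evenFun_evenPetal_self hj1 hj2, evenFun_evenEnd hj2] at this
    omega
  · omega

/-- **The even witness never revisits a site on `[0, 8m + 18 + 2k]`.** [cite: BDGS2012, §1.3] -/
theorem evenWitness_ne {t t' : ℕ} (htt : t' < t) (ht : t ≤ 2 * k + 8 * m + 18) :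
    evenWitness m k t' ≠ evenWitness m k t := by
  intro heq
  have hX := congrArg (spineCoord (m + 1)) heq
  have hY := congrArg (planeCoord (m + 1)) heq
  rcases evenWitness_zones (m := m) (k := k) (t := t) ht with
      hA | ⟨hB1, hB2⟩ | ⟨s, hs, rfl⟩ | ⟨j, r, hj1, hj2, hr, rfl⟩ | rfl
  · -- excursion along the spine: `x₀ = t` is injective
    rw [evenWitness_of_le hA, evenWitness_of_le (show t' ≤ k + 2 by omega)] at hX
    simp only [spineCoord_spinePt] at hX; omega
  · rw [evenWitness_leg hB1 hB2] at hX hY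
    simp only [spineCoord_add, spineCoord_spinePt, spineCoord_planeVec, planeCoord_add,
      planeCoord_spinePt, planeCoord_planeVec] at hX hY
    rcases Nat.lt_or_ge t' (k + 3) with h | h
    · rw [evenWitness_of_le (by omega)] at hY; simp at hY
    · rw [evenWitness_leg h (by omega)] at hX
      simp only [spineCoord_add, spineCoord_spinePt, spineCoord_planeVec] at hX; omega
  · -- head sites: compare with the statistics of the earlier site `t'`
    have hF0 := congrArg (evenFun m 0) heq
    have hF1 := congrArg (evenFun m 1) heq
    rw [evenWitness_head hs] at hX hY hF0 hF1
    rw [spineCoord_evenHead] at hX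
    rw [planeCoord_evenHead] at hY
    rw [evenFun_evenHead (by omega)] at hF0 hF1
    simp only [evenFun_evenLat_self] at hF0 hF1
    have hneg : evenFun m 1 (evenLat m 0) ≤ 0 := evenFun_evenLat_le (by omega) (by omega) (by omega)
    have hneg' : evenFun m 0 (evenLat m 1) ≤ 0 := evenFun_evenLat_le (by omega) (by omega) (by omega)
    rcases Nat.lt_or_ge t' (2 * k + 4) with h4 | h4
    · -- `t'` on the spine excursion or the return leg
      have key : planeCoord (m + 1) (evenWitness m k t') ≤ 1 ∧ 0 ≤ spineCoord (m + 1) (evenWitness m k t') ∧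
          (planeCoord (m + 1) (evenWitness m k t') = 0 ∨ 2 ≤ spineCoord (m + 1) (evenWitness m k t')) ∧
          evenFun m 0 (evenWitness m k t') = 0 ∧ evenFun m 1 (evenWitness m k t') = 0 := by
        have hp0 : evenFun m 0 (planeVec (m + 1)) = 0 := evenFun_planeVec (by omega)
        have hp1 : evenFun m 1 (planeVec (m + 1)) = 0 := evenFun_planeVec (by omega)
        rcases Nat.lt_or_ge t' (k + 3) with hA | hB
        · rw [evenWitness_of_le (by omega)]
          simp only [planeCoord_spinePt, spineCoord_spinePt, evenFun_spinePt]
          exact ⟨by omega, by omega, Or.inl trivial, trivial, trivial⟩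
        · rw [evenWitness_leg hB (by omega)]
          simp only [planeCoord_add, planeCoord_spinePt, planeCoord_planeVec, spineCoord_add,
            spineCoord_spinePt, spineCoord_planeVec, evenFun_add, evenFun_spinePt, hp0, hp1]
          omega
      obtain ⟨q1, q2, q3, q4, q5⟩ := key
      interval_cases s <;> (revert hX hY hF0 hF1; norm_num; first | done | (intros; omega))
    · -- `t'` is an earlier head site `s' < s`
      obtain ⟨s', hs', rfl⟩ : ∃ s', s' < s ∧ t' = 2 * k + 4 + s' := ⟨t' - (2 * k + 4), by omega, by omega⟩
      rw [evenWitness_head (by omega)] at hX hY hF0 hF1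
      rw [spineCoord_evenHead] at hX
      rw [planeCoord_evenHead] at hY
      rw [evenFun_evenHead (by omega)] at hF0 hF1
      simp only [evenFun_evenLat_self] at hF0 hF1
      interval_cases s <;> interval_cases s' <;>
        (revert hX hY hF0 hF1; norm_num; first | done | (intros; omega))
  · -- petal `j`, position `r`
    have hFj := congrArg (evenFun m j) heq
    have hFp := congrArg (evenFun m (j - 1)) heq
    rw [evenWitness_petal hj1 hj2 hr] at hX hY hFj hFp
    rw [evenFun_evenPetal_self hj1 hj2] at hFj
    rw [evenFun_pred_evenPetal hj1 hj2] at hFp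
    rw [spineCoord_evenPetal] at hX
    rw [planeCoord_evenPetal (by omega) hj2] at hY
    rcases Nat.lt_or_ge t' (2 * k + 4 * j + 10) with h | h
    · have := evenFun_evenWitness_nonpos (m := m) (k := k) hj1 hj2 h
      omega
    · obtain ⟨r', hr', rfl⟩ : ∃ r', r' < r ∧ t' = 2 * k + 4 * j + 10 + r' :=
        ⟨t' - (2 * k + 4 * j + 10), by omega, by omega⟩
      rw [evenWitness_petal hj1 hj2 (by omega), evenFun_pred_evenPetal hj1 hj2] at hFp
      rw [evenWitness_petal hj1 hj2 (by omega), spineCoord_evenPetal] at hX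
      rw [evenWitness_petal hj1 hj2 (by omega), planeCoord_evenPetal (by omega) hj2] at hY
      split_ifs at hFp hX hY <;> omega
  · exact evenWitness_ne_end htt (heq.trans (evenWitness_of_ge le_rfl))


/-! #### Consecutive sites are adjacent -/

/-- Values of `evenPetal` (even petal). [cite: BDGS2012, §1.3] -/
theorem evenPetal_even {j : ℕ} (hj : j % 2 = 0) :
    evenPetal m j 0 = evenEnd m + evenLat m (j - 1) + evenLat m j ∧ evenPetal m j 1 = evenEnd m + evenLat m j ∧
      evenPetal m j 2 = spinePt (m + 1) 1 + evenLat m j ∧ evenPetal m j 3 = evenLat m j := by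
  simp [evenPetal, hj]

/-- Values of `evenPetal` (odd petal). [cite: BDGS2012, §1.3] -/
theorem evenPetal_odd {j : ℕ} (hj : j % 2 = 1) :
    evenPetal m j 0 = evenLat m (j - 1) + evenLat m j ∧ evenPetal m j 1 = evenLat m j ∧
      evenPetal m j 2 = spinePt (m + 1) 1 + evenLat m j ∧ evenPetal m j 3 = evenEnd m + evenLat m j := by
  simp [evenPetal, hj]

/-- Values of `evenHead`, as a list of equations. [cite: BDGS2012, §1.3] -/
theorem evenHead_values :
    evenHead m 0 = spinePt (m + 1) 2 + planeVec (m + 1) + planeVec (m + 1) ∧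
    evenHead m 1 = spinePt (m + 1) 1 + planeVec (m + 1) + planeVec (m + 1) ∧
    evenHead m 2 = planeVec (m + 1) + planeVec (m + 1) ∧ evenHead m 3 = planeVec (m + 1) ∧
    evenHead m 4 = planeVec (m + 1) + evenLat m 0 ∧ evenHead m 5 = evenEnd m + evenLat m 0 ∧
    evenHead m 6 = spinePt (m + 1) 1 + evenLat m 0 ∧ evenHead m 7 = evenLat m 0 ∧
    evenHead m 8 = spinePt (m + 1) (-1) + evenLat m 0 ∧ evenHead m 9 = spinePt (m + 1) (-1) ∧
    evenHead m 10 = spinePt (m + 1) (-1) + evenLat m 1 ∧ evenHead m 11 = evenLat m 1 ∧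
    evenHead m 12 = spinePt (m + 1) 1 + evenLat m 1 ∧ evenHead m 13 = evenEnd m + evenLat m 1 := by
  simp [evenHead]

/-- **Consecutive sites of the even witness are lattice neighbours.** [cite: BDGS2012, §1.3] -/
theorem evenWitness_adj {i : ℕ} (hi : i < 2 * k + 8 * m + 18) :
    (zdGraph (m + 1 + 2)).Adj (evenWitness m k i) (evenWitness m k (i + 1)) := by
  obtain ⟨v0, v1, v2, v3, v4, v5, v6, v7, v8, v9, v10, v11, v12, v13⟩ := evenHead_values (m := m)
  rcases evenWitness_zones (m := m) (k := k) (t := i) hi.le with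
      hA | ⟨hB1, hB2⟩ | ⟨s, hs, rfl⟩ | ⟨j, r, hj1, hj2, hr, rfl⟩ | hE
  · rcases Nat.lt_or_ge i (k + 2) with h | h
    · rw [evenWitness_of_le hA, evenWitness_of_le (by omega : i + 1 ≤ k + 2),
        show spinePt (m + 1) ((i + 1 : ℕ) : ℤ) = spinePt (m + 1) (i : ℤ) + spinePt (m + 1) 1 by
          rw [spinePt_add]; push_cast; ring_nf]
      exact adj_add_spinePt_one _
    · have hi' : i = k + 2 := by omega
      subst hi'
      rw [evenWitness_of_le le_rfl, evenWitness_leg (by omega) (by omega),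
        show ((2 * k + 5 : ℕ) : ℤ) - ((k + 2 + 1 : ℕ) : ℤ) = ((k + 2 : ℕ) : ℤ) by push_cast; ring]
      exact adj_add_planeVec _
  · rcases Nat.lt_or_ge i (2 * k + 3) with h | h
    · rw [evenWitness_leg hB1 hB2, evenWitness_leg (by omega) (by omega),
        show spinePt (m + 1) (((2 * k + 5 : ℕ) : ℤ) - (i : ℤ)) + planeVec (m + 1) =
          spinePt (m + 1) (((2 * k + 5 : ℕ) : ℤ) - ((i + 1 : ℕ) : ℤ)) + planeVec (m + 1) + spinePt (m + 1) 1 by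
          rw [add_right_comm (spinePt (m + 1) _) (planeVec (m + 1)) (spinePt (m + 1) 1), spinePt_add]
          congr 2; push_cast; ring]
      exact adj_add_spinePt_one' _
    · have hi' : i = 2 * k + 3 := by omega
      subst hi'
      rw [evenWitness_leg hB1 hB2, show 2 * k + 3 + 1 = 2 * k + 4 + 0 by omega, evenWitness_head (by omega), v0,
        show ((2 * k + 5 : ℕ) : ℤ) - ((2 * k + 3 : ℕ) : ℤ) = 2 by push_cast; ring]
      exact adj_add_planeVec _
  · rcases Nat.lt_or_ge s 13 with h | h
    · rw [show 2 * k + 4 + s + 1 = 2 * k + 4 + (s + 1) by omega, evenWitness_head hs, evenWitness_head (by omega)]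
      interval_cases s
      · rw [v0, v1, show spinePt (m + 1) 2 + planeVec (m + 1) + planeVec (m + 1) =
            spinePt (m + 1) 1 + planeVec (m + 1) + planeVec (m + 1) + spinePt (m + 1) 1 by
            rw [add_right_comm (spinePt (m + 1) 1 + planeVec (m + 1)), add_right_comm (spinePt (m + 1) 1),
              spinePt_add]; norm_num]
        exact adj_add_spinePt_one' _
      · rw [v1, v2, show spinePt (m + 1) 1 + planeVec (m + 1) + planeVec (m + 1) =
            planeVec (m + 1) + planeVec (m + 1) + spinePt (m + 1) 1 by abel]
        exact adj_add_spinePt_one' _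
      · rw [v2, v3]; exact adj_add_planeVec' _
      · rw [v3, v4]; exact adj_add_latVec _ _
      · rw [v4, v5, evenEnd, show spinePt (m + 1) 1 + planeVec (m + 1) + evenLat m 0 =
            planeVec (m + 1) + evenLat m 0 + spinePt (m + 1) 1 by abel]
        exact adj_add_spinePt_one _
      · rw [v5, v6, evenEnd, show spinePt (m + 1) 1 + planeVec (m + 1) + evenLat m 0 =
            spinePt (m + 1) 1 + evenLat m 0 + planeVec (m + 1) by abel]
        exact adj_add_planeVec' _
      · rw [v6, v7, add_comm (spinePt (m + 1) 1) (evenLat m 0)]; exact adj_add_spinePt_one' _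
      · rw [v7, v8]
        have h := adj_add_spinePt_one' (spinePt (m + 1) (-1) + evenLat m 0)
        rwa [add_right_comm (spinePt (m + 1) (-1)) (evenLat m 0) (spinePt (m + 1) 1), spinePt_add,
          show (-1 : ℤ) + 1 = 0 by norm_num, spinePt_zero, zero_add] at h
      · rw [v8, v9]; exact adj_add_latVec' _ _
      · rw [v9, v10]; exact adj_add_latVec _ _
      · rw [v10, v11]
        have h := adj_add_spinePt_one (spinePt (m + 1) (-1) + evenLat m 1)
        rwa [add_right_comm (spinePt (m + 1) (-1)) (evenLat m 1) (spinePt (m + 1) 1), spinePt_add,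
          show (-1 : ℤ) + 1 = 0 by norm_num, spinePt_zero, zero_add] at h
      · rw [v11, v12, add_comm (spinePt (m + 1) 1) (evenLat m 1)]; exact adj_add_spinePt_one _
      · rw [v12, v13, evenEnd, show spinePt (m + 1) 1 + planeVec (m + 1) + evenLat m 1 =
            spinePt (m + 1) 1 + evenLat m 1 + planeVec (m + 1) by abel]
        exact adj_add_planeVec _
    · have hs13 : s = 13 := by omega
      subst hs13
      rw [evenWitness_head hs, v13]
      rcases Nat.eq_zero_or_pos m with rfl | hm
      · rw [evenWitness_of_ge (by omega)]
        exact adj_add_latVec' _ _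
      · rw [show 2 * k + 4 + 13 + 1 = 2 * k + 4 * 2 + 10 + 0 by ring, evenWitness_petal le_rfl (by omega) (by omega),
          (evenPetal_even (show 2 % 2 = 0 by rfl)).1]
        exact adj_add_latVec _ _
  · rcases Nat.lt_or_ge r 3 with h | h
    · rw [show 2 * k + 4 * j + 10 + r + 1 = 2 * k + 4 * j + 10 + (r + 1) by omega, evenWitness_petal hj1 hj2 hr,
        evenWitness_petal hj1 hj2 (by omega)]
      rcases Nat.mod_two_eq_zero_or_one j with hj | hj
      · obtain ⟨h0, h1, h2, h3⟩ := evenPetal_even (m := m) hj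
        interval_cases r
        · rw [h0, h1, add_right_comm (evenEnd m) (evenLat m (j - 1)) (evenLat m j)]
          exact adj_add_latVec' _ _
        · rw [h1, h2, evenEnd, add_right_comm (spinePt (m + 1) 1) (planeVec (m + 1)) (evenLat m j)]
          exact adj_add_planeVec' _
        · rw [h2, h3, add_comm (spinePt (m + 1) 1) (evenLat m j)]; exact adj_add_spinePt_one' _
      · obtain ⟨h0, h1, h2, h3⟩ := evenPetal_odd (m := m) hj
        interval_cases r
        · rw [h0, h1, add_comm (evenLat m (j - 1)) (evenLat m j)]; exact adj_add_latVec' _ _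
        · rw [h1, h2, add_comm (spinePt (m + 1) 1) (evenLat m j)]; exact adj_add_spinePt_one _
        · rw [h2, h3, evenEnd, add_right_comm (spinePt (m + 1) 1) (planeVec (m + 1)) (evenLat m j)]
          exact adj_add_planeVec _
    · obtain rfl : r = 3 := by omega
      rw [evenWitness_petal hj1 hj2 hr]
      rcases Nat.mod_two_eq_zero_or_one j with hj | hj
      · -- an even petal ends at `u_j`; the next (odd) petal starts at the corner `u_j + u_{j+1}`
        have hj3 : j + 1 ≤ 2 * m + 1 := by omega
        rw [show 2 * k + 4 * j + 10 + 3 + 1 = 2 * k + 4 * (j + 1) + 10 + 0 by ring,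
          evenWitness_petal (by omega) hj3 (by omega), (evenPetal_even hj).2.2.2,
          (evenPetal_odd (show (j + 1) % 2 = 1 by omega)).1, Nat.add_sub_cancel]
        exact adj_add_latVec _ _
      · rw [(evenPetal_odd hj).2.2.2]
        rcases Nat.lt_or_ge j (2 * m + 1) with hj3 | hj3
        · rw [show 2 * k + 4 * j + 10 + 3 + 1 = 2 * k + 4 * (j + 1) + 10 + 0 by ring,
            evenWitness_petal (by omega) (by omega) (by omega),
            (evenPetal_even (show (j + 1) % 2 = 0 by omega)).1, Nat.add_sub_cancel]
          exact adj_add_latVec _ _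
        · rw [evenWitness_of_ge (by omega)]
          exact adj_add_latVec' _ _
  · omega

/-! #### The cage of the end and the neighbours of the start -/

/-- A unit coordinate vector of `ℤ^{m+3}` is `e₀`, `e₁`, or one of the laterals `evenLat`.
[cite: MadrasSlade1993, §1.1] -/
theorem single_eq_evenLat (a : Fin (m + 1 + 2)) :
    ((a : ℕ) = 0 ∧ Pi.single a (1 : ℤ) = spinePt (m + 1) 1) ∨
      ((a : ℕ) = 1 ∧ Pi.single a (1 : ℤ) = planeVec (m + 1)) ∨
      (2 ≤ (a : ℕ) ∧ Pi.single a (1 : ℤ) = evenLat m (a - 2) ∧ -Pi.single a (1 : ℤ) = evenLat m (a + m - 1)) := by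
  rcases Nat.lt_or_ge a 2 with h | h
  · rcases Nat.lt_or_ge a 1 with h1 | h1
    · refine Or.inl ⟨by omega, ?_⟩
      have : a = axisFin (m + 1) 0 := Fin.ext (by rw [axisFin_val (by omega)]; omega)
      rw [this]; rfl
    · refine Or.inr (Or.inl ⟨by omega, ?_⟩)
      have : a = axisFin (m + 1) 1 := Fin.ext (by rw [axisFin_val (by omega)]; omega)
      rw [this]; rfl
  · refine Or.inr (Or.inr ⟨h, ?_, ?_⟩)
    · have ha : axisFin (m + 1) (2 + (a - 2)) = a := Fin.ext (by rw [axisFin_val (by omega)]; omega)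
      simp [evenLat, latVec, show (a : ℕ) - 2 < m + 1 by omega, ha]
    · have ha : axisFin (m + 1) (2 + (a + m - 1) - (m + 1)) = a :=
        Fin.ext (by rw [axisFin_val (by omega)]; omega)
      simp [evenLat, latVec, show ¬ (a : ℕ) + m - 1 < m + 1 by omega, ha]

/-- Every site `e + evenLat j` is visited. [cite: BDGS2012, §1.3] -/
theorem exists_evenWitness_eq_end_add {j : ℕ} (hj : j ≤ 2 * m + 1) :
    ∃ i < 2 * k + 8 * m + 18 + 1, evenWitness m k i = evenEnd m + evenLat m j := by
  obtain ⟨-, -, -, -, -, v5, -, -, -, -, -, -, -, v13⟩ := evenHead_values (m := m)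
  rcases Nat.lt_or_ge j 2 with h | h
  · rcases Nat.lt_or_ge j 1 with h1 | h1
    · obtain rfl : j = 0 := by omega
      exact ⟨2 * k + 4 + 5, by omega, by rw [evenWitness_head (by omega), v5]⟩
    · obtain rfl : j = 1 := by omega
      exact ⟨2 * k + 4 + 13, by omega, by rw [evenWitness_head (by omega), v13]⟩
  · rcases Nat.mod_two_eq_zero_or_one j with hj2 | hj2
    · exact ⟨2 * k + 4 * j + 10 + 1, by omega, by rw [evenWitness_petal h hj (by omega), (evenPetal_even hj2).2.1]⟩
    · exact ⟨2 * k + 4 * j + 10 + 3, by omega,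
        by rw [evenWitness_petal h hj (by omega), (evenPetal_odd hj2).2.2.2]⟩

/-- Every lateral `evenLat j` is visited. [cite: BDGS2012, §1.3] -/
theorem exists_evenWitness_eq_lat {j : ℕ} (hj : j ≤ 2 * m + 1) :
    ∃ i < 2 * k + 8 * m + 18 + 1, evenWitness m k i = evenLat m j := by
  obtain ⟨-, -, -, -, -, -, -, v7, -, -, -, v11, -, -⟩ := evenHead_values (m := m)
  rcases Nat.lt_or_ge j 2 with h | h
  · rcases Nat.lt_or_ge j 1 with h1 | h1
    · obtain rfl : j = 0 := by omega
      exact ⟨2 * k + 4 + 7, by omega, by rw [evenWitness_head (by omega), v7]⟩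
    · obtain rfl : j = 1 := by omega
      exact ⟨2 * k + 4 + 11, by omega, by rw [evenWitness_head (by omega), v11]⟩
  · rcases Nat.mod_two_eq_zero_or_one j with hj2 | hj2
    · exact ⟨2 * k + 4 * j + 10 + 3, by omega,
        by rw [evenWitness_petal h hj (by omega), (evenPetal_even hj2).2.2.2]⟩
    · exact ⟨2 * k + 4 * j + 10 + 1, by omega, by rw [evenWitness_petal h hj (by omega), (evenPetal_odd hj2).2.1]⟩

/-- **The even witness is doubly trapped**: an `(8m + 18 + 2k)`-step self-avoiding walk on `ℤ^{m+3}`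
from `0` whose end `e₀ + e₁` has all `2(m+3)` neighbours on the walk and whose start has the single
free neighbour `-e₁`. [cite: BDGS2012, §1.3] -/
theorem evenWitness_mem_doublyTrapped (m k : ℕ) :
    evenWitness m k ∈ doublyTrapped (m + 1 + 2) (2 * k + 8 * m + 18) := by
  have hn : evenWitness m k (2 * k + 8 * m + 18) = evenEnd m := evenWitness_of_ge le_rfl
  obtain ⟨-, v1, -, v3, -, -, -, -, -, v9, -, -, -, -⟩ := evenHead_values (m := m)
  refine mem_doublyTrapped_of_forall ?_ ?_ (fun i hi => evenWitness_adj hi) ?_ ?_ (-planeVec (m + 1)) ?_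
  · rw [evenWitness_of_le (Nat.zero_le _)]; simp
  · intro i hi; rw [evenWitness_of_ge hi, hn]
  · intro i hi j hj hij
    rcases lt_trichotomy i j with h | h | h
    · exact absurd hij (evenWitness_ne h (by omega))
    · exact h
    · exact absurd hij.symm (evenWitness_ne h (by omega))
  · intro a
    rw [hn]
    rcases single_eq_evenLat (m := m) a with ⟨-, ha⟩ | ⟨-, ha⟩ | ⟨ha1, ha, ha'⟩
    · rw [ha]
      refine ⟨⟨2 * k + 3, by omega, ?_⟩, ⟨2 * k + 4 + 3, by omega, ?_⟩⟩
      · rw [evenWitness_leg (by omega) le_rfl, evenEnd,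
          add_right_comm (spinePt (m + 1) 1) (planeVec (m + 1)) (spinePt (m + 1) 1), spinePt_add]
        congr 2; push_cast; ring
      · rw [evenWitness_head (by omega), v3, evenEnd]; abel
    · rw [ha]
      refine ⟨⟨2 * k + 4 + 1, by omega, ?_⟩, ⟨1, by omega, ?_⟩⟩
      · rw [evenWitness_head (by omega), v1, evenEnd]
      · rw [evenWitness_of_le (by omega), evenEnd]; simp
    · rw [sub_eq_add_neg, ha', ha]
      exact ⟨exists_evenWitness_eq_end_add (by omega), exists_evenWitness_eq_end_add (by omega)⟩
  · intro a
    rcases single_eq_evenLat (m := m) a with ⟨-, ha⟩ | ⟨-, ha⟩ | ⟨ha1, ha, ha'⟩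
    · rw [ha]
      refine ⟨Or.inl ⟨1, by omega, ?_⟩, Or.inl ⟨2 * k + 4 + 9, by omega, ?_⟩⟩
      · rw [evenWitness_of_le (by omega)]; simp
      · rw [evenWitness_head (by omega), v9]; simp only [spinePt, Pi.single_neg]
    · rw [ha]
      exact ⟨Or.inl ⟨2 * k + 4 + 3, by omega, by rw [evenWitness_head (by omega), v3]⟩, Or.inr rfl⟩
    · rw [ha', ha]
      exact ⟨Or.inl (exists_evenWitness_eq_lat (by omega)), Or.inl (exists_evenWitness_eq_lat (by omega))⟩

end EvenWitness


/-! ### The planar even witness (`d = 2`) -/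

/-- The seven head sites of the planar witness: `0, -e₀, -e₀+e₁, e₁, 2e₁, e₀+2e₁, 2e₀+2e₁`. [cite: BDGS2012, §1.3] -/
def evenHeadTwo (s : ℕ) : Site (0 + 2) :=
  if s = 0 then 0
  else if s = 1 then spinePt 0 (-1)
  else if s = 2 then spinePt 0 (-1) + planeVec 0
  else if s = 3 then planeVec 0
  else if s = 4 then planeVec 0 + planeVec 0
  else if s = 5 then spinePt 0 1 + planeVec 0 + planeVec 0
  else spinePt 0 2 + planeVec 0 + planeVec 0

/-- **The planar even witness** with padding `k`: the seven head sites, then `2e₀+e₁, …, (k+2)e₀+e₁`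
(out along `x₁ = 1`), `(k+2)e₀, …, e₀` (back along the spine) and the end `e₀ + e₁`; frozen after
time `10 + 2k`. [cite: BDGS2012, §1.3] -/
def evenWitnessTwo (k : ℕ) (t : ℕ) : Site (0 + 2) :=
  if t ≤ 6 then evenHeadTwo t
  else if t ≤ k + 7 then spinePt 0 ((t : ℤ) - 5) + planeVec 0
  else if t ≤ 2 * k + 9 then spinePt 0 ((2 * k + 10 : ℕ) - (t : ℤ))
  else spinePt 0 1 + planeVec 0

section EvenWitnessTwo

variable {k : ℕ}

/-- Head phase. [cite: BDGS2012, §1.3] -/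
theorem evenWitnessTwo_head {t : ℕ} (ht : t ≤ 6) : evenWitnessTwo k t = evenHeadTwo t := by
  simp [evenWitnessTwo, ht]

/-- Out along `x₁ = 1`. [cite: BDGS2012, §1.3] -/
theorem evenWitnessTwo_out {t : ℕ} (h1 : 7 ≤ t) (h2 : t ≤ k + 7) :
    evenWitnessTwo k t = spinePt 0 ((t : ℤ) - 5) + planeVec 0 := by
  simp [evenWitnessTwo, show ¬ t ≤ 6 by omega, h2]

/-- Back along the spine. [cite: BDGS2012, §1.3] -/
theorem evenWitnessTwo_back {t : ℕ} (h1 : k + 8 ≤ t) (h2 : t ≤ 2 * k + 9) :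
    evenWitnessTwo k t = spinePt 0 ((2 * k + 10 : ℕ) - (t : ℤ)) := by
  simp [evenWitnessTwo, show ¬ t ≤ 6 by omega, show ¬ t ≤ k + 7 by omega, h2]

/-- End phase. [cite: BDGS2012, §1.3] -/
theorem evenWitnessTwo_of_ge {t : ℕ} (ht : 2 * k + 10 ≤ t) : evenWitnessTwo k t = spinePt 0 1 + planeVec 0 := by
  simp [evenWitnessTwo, show ¬ t ≤ 6 by omega, show ¬ t ≤ k + 7 by omega, show ¬ t ≤ 2 * k + 9 by omega]

/-- Values of the head. [cite: BDGS2012, §1.3] -/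
theorem evenHeadTwo_values :
    evenHeadTwo 0 = 0 ∧ evenHeadTwo 1 = spinePt 0 (-1) ∧ evenHeadTwo 2 = spinePt 0 (-1) + planeVec 0 ∧
    evenHeadTwo 3 = planeVec 0 ∧ evenHeadTwo 4 = planeVec 0 + planeVec 0 ∧
    evenHeadTwo 5 = spinePt 0 1 + planeVec 0 + planeVec 0 ∧ evenHeadTwo 6 = spinePt 0 2 + planeVec 0 + planeVec 0 := by
  simp [evenHeadTwo]

/-- Coordinates of the head sites: `(0,0), (-1,0), (-1,1), (0,1), (0,2), (1,2), (2,2)`. [cite: BDGS2012, §1.3] -/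
theorem coords_evenHeadTwo (s : ℕ) :
    spineCoord 0 (evenHeadTwo s) = (if s = 0 then 0 else if s ≤ 2 then -1 else if s ≤ 4 then 0 else if s = 5 then 1 else 2) ∧
    planeCoord 0 (evenHeadTwo s) = (if s ≤ 1 then 0 else if s ≤ 3 then 1 else 2) := by
  unfold evenHeadTwo
  by_cases h0 : s = 0; · subst h0; simp [spineCoord, planeCoord]
  by_cases h1 : s = 1; · subst h1; simp
  by_cases h2 : s = 2; · subst h2; simp
  by_cases h3 : s = 3; · subst h3; simp
  by_cases h4 : s = 4; · subst h4; simp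
  by_cases h5 : s = 5; · subst h5; simp
  simp [h0, h1, h2, h3, h4, h5, show ¬ s ≤ 2 by omega, show ¬ s ≤ 4 by omega, show ¬ s ≤ 1 by omega,
    show ¬ s ≤ 3 by omega]

/-- On the head, `x₀ ≤ 0` unless `x₁ = 2`, and `x₁ ≤ 2`. [cite: BDGS2012, §1.3] -/
theorem coords_evenHeadTwo_le (s : ℕ) :
    (spineCoord 0 (evenHeadTwo s) ≤ 0 ∨ planeCoord 0 (evenHeadTwo s) = 2) ∧ planeCoord 0 (evenHeadTwo s) ≤ 2 := by
  obtain ⟨h1, h2⟩ := coords_evenHeadTwo s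
  rw [h1, h2]
  constructor
  · split_ifs <;> first | (left; omega) | (right; rfl)
  · split_ifs <;> omega

/-- **The planar even witness never revisits a site on `[0, 10 + 2k]`.** [cite: BDGS2012, §1.3] -/
theorem evenWitnessTwo_ne {t t' : ℕ} (htt : t' < t) (ht : t ≤ 2 * k + 10) :
    evenWitnessTwo k t' ≠ evenWitnessTwo k t := by
  intro heq
  have hX := congrArg (spineCoord 0) heq
  have hY := congrArg (planeCoord 0) heq
  rcases Nat.lt_or_ge t 7 with hA | hA
  · -- both on the head
    rw [evenWitnessTwo_head (by omega), evenWitnessTwo_head (by omega), (coords_evenHeadTwo t).1,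
      (coords_evenHeadTwo t').1] at hX
    rw [evenWitnessTwo_head (by omega), evenWitnessTwo_head (by omega), (coords_evenHeadTwo t).2,
      (coords_evenHeadTwo t').2] at hY
    interval_cases t <;> interval_cases t' <;> (revert hX hY; norm_num)
  -- statistics of an earlier head site
  have head' : t' ≤ 6 → (spineCoord 0 (evenWitnessTwo k t') ≤ 0 ∨ planeCoord 0 (evenWitnessTwo k t') = 2) ∧
      planeCoord 0 (evenWitnessTwo k t') ≤ 2 := fun h => by
    rw [evenWitnessTwo_head h]; exact coords_evenHeadTwo_le t'
  rcases Nat.lt_or_ge t (k + 8) with hB | hB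
  · -- `t` out along `x₁ = 1`, `x₀ = t - 5 ≥ 2`
    rw [evenWitnessTwo_out hA (by omega)] at hX hY
    simp only [spineCoord_add, spineCoord_spinePt, spineCoord_planeVec, planeCoord_add, planeCoord_spinePt,
      planeCoord_planeVec] at hX hY
    rcases Nat.lt_or_ge t' 7 with h | h
    · obtain ⟨h1 | h1, h2⟩ := head' (by omega) <;> omega
    · rw [evenWitnessTwo_out h (by omega)] at hX
      simp only [spineCoord_add, spineCoord_spinePt, spineCoord_planeVec] at hX; omega
  rcases Nat.lt_or_ge t (2 * k + 10) with hC | hC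
  · -- `t` back along the spine, `x₁ = 0`, `x₀ ≥ 1`
    rw [evenWitnessTwo_back hB (by omega)] at hX hY
    simp only [spineCoord_spinePt, planeCoord_spinePt] at hX hY
    rcases Nat.lt_or_ge t' 7 with h | h
    · obtain ⟨h1 | h1, h2⟩ := head' (by omega) <;> omega
    rcases Nat.lt_or_ge t' (k + 8) with h' | h'
    · rw [evenWitnessTwo_out h (by omega)] at hY
      simp only [planeCoord_add, planeCoord_spinePt, planeCoord_planeVec] at hY; omega
    · rw [evenWitnessTwo_back h' (by omega)] at hX
      simp only [spineCoord_spinePt] at hX; omega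
  · -- `t` is the end `e₀ + e₁`
    obtain rfl : t = 2 * k + 10 := by omega
    rw [evenWitnessTwo_of_ge le_rfl] at hX hY
    simp only [spineCoord_add, spineCoord_spinePt, spineCoord_planeVec, planeCoord_add, planeCoord_spinePt,
      planeCoord_planeVec] at hX hY
    rcases Nat.lt_or_ge t' 7 with h | h
    · obtain ⟨h1 | h1, h2⟩ := head' (by omega) <;> omega
    rcases Nat.lt_or_ge t' (k + 8) with h' | h'
    · rw [evenWitnessTwo_out h (by omega)] at hX
      simp only [spineCoord_add, spineCoord_spinePt, spineCoord_planeVec] at hX; omega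
    · rw [evenWitnessTwo_back h' (by omega)] at hY
      simp only [planeCoord_spinePt] at hY; omega

/-- **Consecutive sites of the planar even witness are lattice neighbours.** [cite: BDGS2012, §1.3] -/
theorem evenWitnessTwo_adj {i : ℕ} (hi : i < 2 * k + 10) :
    (zdGraph (0 + 2)).Adj (evenWitnessTwo k i) (evenWitnessTwo k (i + 1)) := by
  obtain ⟨v0, v1, v2, v3, v4, v5, v6⟩ := evenHeadTwo_values
  rcases Nat.lt_or_ge i 6 with h | h
  · rw [evenWitnessTwo_head (by omega), evenWitnessTwo_head (by omega)]
    interval_cases i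
    · rw [v0, v1]
      have h := adj_add_spinePt_one' (spinePt 0 (-1))
      rwa [spinePt_add, show (-1 : ℤ) + 1 = 0 by norm_num, spinePt_zero] at h
    · rw [v1, v2]; exact adj_add_planeVec _
    · rw [v2, v3]
      have h := adj_add_spinePt_one (spinePt 0 (-1) + planeVec 0)
      rwa [add_right_comm (spinePt 0 (-1)) (planeVec 0) (spinePt 0 1), spinePt_add,
        show (-1 : ℤ) + 1 = 0 by norm_num, spinePt_zero, zero_add (planeVec 0)] at h
    · rw [v3, v4]; exact adj_add_planeVec _
    · rw [v4, v5, show spinePt 0 1 + planeVec 0 + planeVec 0 = planeVec 0 + planeVec 0 + spinePt 0 1 by abel]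
      exact adj_add_spinePt_one _
    · rw [v5, v6, show spinePt 0 2 + planeVec 0 + planeVec 0 = spinePt 0 1 + planeVec 0 + planeVec 0 + spinePt 0 1 by
          rw [add_right_comm (spinePt 0 1 + planeVec 0) (planeVec 0) (spinePt 0 1),
            add_right_comm (spinePt 0 1) (planeVec 0) (spinePt 0 1), spinePt_add]; norm_num]
      exact adj_add_spinePt_one _
  rcases Nat.lt_or_ge i 7 with h6 | h6
  · obtain rfl : i = 6 := by omega
    rw [evenWitnessTwo_head le_rfl, v6, evenWitnessTwo_out le_rfl (by omega),
      show ((6 + 1 : ℕ) : ℤ) - 5 = 2 by norm_num]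
    exact adj_add_planeVec' _
  rcases Nat.lt_or_ge i (k + 7) with h7 | h7
  · rw [evenWitnessTwo_out h6 (by omega), evenWitnessTwo_out (by omega) (by omega),
      show spinePt 0 (((i + 1 : ℕ) : ℤ) - 5) + planeVec 0 = spinePt 0 ((i : ℤ) - 5) + planeVec 0 + spinePt 0 1 by
        rw [add_right_comm (spinePt 0 _) (planeVec 0) (spinePt 0 1), spinePt_add]; congr 2; push_cast; ring]
    exact adj_add_spinePt_one _
  rcases Nat.lt_or_ge i (k + 8) with h8 | h8
  · obtain rfl : i = k + 7 := by omega
    rw [evenWitnessTwo_out h6 le_rfl, evenWitnessTwo_back (by omega) (by omega),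
      show ((2 * k + 10 : ℕ) : ℤ) - ((k + 7 + 1 : ℕ) : ℤ) = ((k + 7 : ℕ) : ℤ) - 5 by push_cast; ring]
    exact adj_add_planeVec' _
  rcases Nat.lt_or_ge i (2 * k + 9) with h9 | h9
  · rw [evenWitnessTwo_back h8 (by omega), evenWitnessTwo_back (by omega) (by omega),
      show spinePt 0 (((2 * k + 10 : ℕ) : ℤ) - (i : ℤ)) =
        spinePt 0 (((2 * k + 10 : ℕ) : ℤ) - ((i + 1 : ℕ) : ℤ)) + spinePt 0 1 by
        rw [spinePt_add]; congr 1; push_cast; ring]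
    exact adj_add_spinePt_one' _
  · obtain rfl : i = 2 * k + 9 := by omega
    rw [evenWitnessTwo_back h8 le_rfl, evenWitnessTwo_of_ge le_rfl,
      show ((2 * k + 10 : ℕ) : ℤ) - ((2 * k + 9 : ℕ) : ℤ) = 1 by push_cast; ring]
    exact adj_add_planeVec _

/-- On `ℤ²` the laterals of `SAWCountMonotoneSharpOdd` are `±e₁`. [cite: MadrasSlade1993, §1.1] -/
theorem oddLat_zero_eq : oddLat 0 0 = planeVec 0 ∧ oddLat 0 1 = -planeVec 0 := by
  constructor <;> simp [oddLat, latVec, planeVec]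

/-- **The planar even witness is doubly trapped** (end `e₀ + e₁` caged, free start site `-e₁`).
[cite: BDGS2012, §1.3] -/
theorem evenWitnessTwo_mem_doublyTrapped (k : ℕ) : evenWitnessTwo k ∈ doublyTrapped (0 + 2) (2 * k + 10) := by
  obtain ⟨v0, v1, v2, v3, v4, v5, v6⟩ := evenHeadTwo_values
  have hn : evenWitnessTwo k (2 * k + 10) = spinePt 0 1 + planeVec 0 := evenWitnessTwo_of_ge le_rfl
  refine mem_doublyTrapped_of_forall (by rw [evenWitnessTwo_head (by omega), v0])
    (fun i hi => by rw [evenWitnessTwo_of_ge hi, hn]) (fun i hi => evenWitnessTwo_adj hi) ?_ ?_ (-planeVec 0) ?_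
  · intro i hi j hj hij
    rcases lt_trichotomy i j with h | h | h
    · exact absurd hij (evenWitnessTwo_ne h (by omega))
    · exact h
    · exact absurd hij.symm (evenWitnessTwo_ne h (by omega))
  · intro a
    rw [hn]
    rcases single_eq_oddLat (m := 0) a with ⟨-, ha⟩ | ⟨ha1, ha, ha'⟩
    · rw [ha]
      refine ⟨⟨7, by omega, ?_⟩, ⟨3, by omega, ?_⟩⟩
      · rw [evenWitnessTwo_out le_rfl (by omega), add_right_comm (spinePt 0 1) (planeVec 0) (spinePt 0 1),
          spinePt_add]; norm_num
      · rw [evenWitnessTwo_head (by omega), v3]; abel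
    · have ha2 : (a : ℕ) = 1 := by have := a.isLt; omega
      have hA : Pi.single a (1 : ℤ) = planeVec 0 := by rw [ha, ha2, Nat.sub_self]; exact oddLat_zero_eq.1
      rw [hA]
      refine ⟨⟨5, by omega, ?_⟩, ⟨2 * k + 9, by omega, ?_⟩⟩
      · rw [evenWitnessTwo_head (by omega), v5]
      · rw [evenWitnessTwo_back (by omega) le_rfl, show ((2 * k + 10 : ℕ) : ℤ) - ((2 * k + 9 : ℕ) : ℤ) = 1 by
          push_cast; ring, add_sub_cancel_right]
  · intro a
    rcases single_eq_oddLat (m := 0) a with ⟨-, ha⟩ | ⟨ha1, ha, ha'⟩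
    · rw [ha]
      refine ⟨Or.inl ⟨2 * k + 9, by omega, ?_⟩, Or.inl ⟨1, by omega, ?_⟩⟩
      · rw [evenWitnessTwo_back (by omega) le_rfl, show ((2 * k + 10 : ℕ) : ℤ) - ((2 * k + 9 : ℕ) : ℤ) = 1 by
          push_cast; ring]
      · rw [evenWitnessTwo_head (by omega), v1]; simp only [spinePt, Pi.single_neg]
    · have ha2 : (a : ℕ) = 1 := by have := a.isLt; omega
      have hA : Pi.single a (1 : ℤ) = planeVec 0 := by rw [ha, ha2, Nat.sub_self]; exact oddLat_zero_eq.1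
      rw [hA]
      exact ⟨Or.inl ⟨3, by omega, by rw [evenWitnessTwo_head (by omega), v3]⟩, Or.inr rfl⟩

end EvenWitnessTwo

/-! ### The threshold law in every dimension -/

/-- **Doubly trapped walks exist at every even length `n ≥ 8d - 6`, in every dimension `d ≥ 2`.**
[cite: BDGS2012, §1.3] -/
theorem doublyTrapped_nonempty_of_even {d n : ℕ} (hd : 2 ≤ d) (hn : Even n) (h : 8 * d ≤ n + 6) :
    (doublyTrapped d n).Nonempty := by
  obtain ⟨a, ha⟩ := hn
  rcases Nat.lt_or_ge d 3 with hd3 | hd3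
  · obtain rfl : d = 2 := by omega
    obtain ⟨k, rfl⟩ : ∃ k, n = 2 * k + 10 := ⟨(n - 10) / 2, by omega⟩
    exact ⟨_, evenWitnessTwo_mem_doublyTrapped k⟩
  · obtain ⟨m, rfl⟩ : ∃ m, d = m + 1 + 2 := ⟨d - 3, by omega⟩
    obtain ⟨k, rfl⟩ : ∃ k, n = 2 * k + 8 * m + 18 := ⟨(n - (8 * m + 18)) / 2, by omega⟩
    exact ⟨_, evenWitness_mem_doublyTrapped m k⟩

/-- **The even half of the threshold law**: for `d ≥ 2` and even `n`, `T₂(d, n) = ∅ ↔ n ≤ 8d - 8`.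
[cite: BDGS2012, §1.3] -/
theorem doublyTrapped_eq_empty_iff_of_even {d n : ℕ} (hd : 2 ≤ d) (hn : Even n) :
    doublyTrapped d n = ∅ ↔ n + 7 ≤ 8 * d := by
  refine ⟨fun h => ?_, fun h => doublyTrapped_eq_empty_of_even hn h⟩
  by_contra h'
  obtain ⟨a, ha⟩ := hn
  exact (doublyTrapped_nonempty_of_even hd ⟨a, ha⟩ (by omega)).ne_empty h

/-- At the even threshold itself: **`T₂(d, 8d - 6) ≠ ∅` for every `d ≥ 2`** (stated with
`n + 6 = 8d`). [cite: BDGS2012, §1.3] -/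
theorem doublyTrapped_nonempty_even_threshold {d n : ℕ} (hd : 2 ≤ d) (hn : n + 6 = 8 * d) :
    (doublyTrapped d n).Nonempty :=
  doublyTrapped_nonempty_of_even hd ⟨4 * d - 3, by omega⟩ (by omega)

/-- **THE DOUBLY TRAPPED THRESHOLD LAW (all dimensions).** For `d ≥ 2`, the set `T₂(d, n)` of
`n`-step self-avoiding walks on `ℤ^d` with a trapped end and at most one free start site is empty
exactly when `n` is odd and `≤ 6d - 5`, or `n` is even and `≤ 8d - 8`. Consequently the reversal
pairing `cₙ ≤ cₙ₊₁ + #T₂` proves O'Brien's inequality `cₙ ≤ cₙ₊₁` precisely for `n ≤ 6d - 4` and the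
even `n ≤ 8d - 8`. [cite: BDGS2012, §1.3] -/
theorem doublyTrapped_eq_empty_iff {d n : ℕ} (hd : 2 ≤ d) :
    doublyTrapped d n = ∅ ↔ (Odd n ∧ n + 5 ≤ 6 * d) ∨ (Even n ∧ n + 7 ≤ 8 * d) := by
  rcases Nat.even_or_odd n with hn | hn
  · rw [doublyTrapped_eq_empty_iff_of_even hd hn]
    have : ¬ Odd n := Nat.not_odd_iff_even.2 hn
    tauto
  · rw [doublyTrapped_eq_empty_iff_of_odd hd hn]
    have : ¬ Even n := Nat.not_even_iff_odd.2 hn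
    tauto

/-- The same law, for nonemptiness: `T₂(d, n) ≠ ∅ ↔ (n odd ∧ n ≥ 6d - 3) ∨ (n even ∧ n ≥ 8d - 6)`.
[cite: BDGS2012, §1.3] -/
theorem doublyTrapped_nonempty_iff {d n : ℕ} (hd : 2 ≤ d) :
    (doublyTrapped d n).Nonempty ↔ (Odd n ∧ 6 * d ≤ n + 3) ∨ (Even n ∧ 8 * d ≤ n + 6) := by
  constructor
  · intro h
    rcases Nat.even_or_odd n with hn | hn
    · refine Or.inr ⟨hn, ?_⟩
      by_contra h'
      obtain ⟨a, rfl⟩ := hn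
      exact h.ne_empty (doublyTrapped_eq_empty_of_even ⟨a, rfl⟩ (by omega))
    · refine Or.inl ⟨hn, ?_⟩
      by_contra h'
      obtain ⟨a, rfl⟩ := hn
      exact h.ne_empty (doublyTrapped_eq_empty_of_odd ⟨a, rfl⟩ (by omega))
  · rintro (⟨hn, h⟩ | ⟨hn, h⟩)
    · exact doublyTrapped_nonempty_of_odd hd hn h
    · exact doublyTrapped_nonempty_of_even hd hn h

end Literature.Probability.RandomPlanarGeometry.SAW.Zd
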